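import Summits.QuantumFields.BalabanUV.T4Continuum.Support.NE7OneStepOfLocalChartWideDec
import Summits.QuantumFields.BalabanUV.T4Continuum.Support.NE7OneStepOfLocalChartRatio
import HarnessLib

/-!
# GEN 95 RE-THREAD (`…Dec`): this file is `NE7OneStepOfLocalChartRatioWide` VERBATIM except that F31's per-pair binder `hleaves` (row NE3's weight currency,
# numerically refuted for arbitrary pairs — memo `t4/b2b-balaban-t4-ne7-p1-g95/WEIGHT-CURRENCY-DEAD.md`) is replaced by F327's honest binder `hdecomp`
# (decomposition `X = X_T + X_N` with its two energy letters and k-free currencies `(α̂, ν̂, κ̂)`) and route Π's uniform block by ONE k-free line;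
# the chart∕budget content is untouched and chain predecessors are the `…Dec` re-issues.  Original docstring follows.

# NE7 — ONE-STEP from the local chart ON THE WIDE COVER in the regime, GENERAL RATIO `δ = λε` (F284cw)

[Balaban1985Variational] Prop 8 ∘ [Balaban1983Laplace] Thm 2, row NE7.  F284c
`NE7OneStepOfLocalChartRatio.oneStep_of_chart_regime_ratio` VERBATIM except that the chart hypothesis is
asked on the `Kc`-fold cover for a FREE `Kc ≥ 4ℓ + 12` (over F283w `NE7OneStepOfLocalChartWide`) instead of
the `(4ℓ+12)`-fold cover, on which for small `N` the chart ball is the whole torus and the hypothesis is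
refuted by torons (gen 91, `NE7LocalChartCoverObstruction.not_chart_cover12`); the consumer takes
`Kc ≥ 2·nbRad (d+1) L + 4ℓ + 24`, making the chart LOCAL.  Ratio `0 < λ < 1` (`δ = λε`, `δ₁ = λε/2`,
`θ = 1/4`, `c₀ = λε/4`); the budget is discharged by F284c's letters (`budgetC_of_regime_ratio`).  Bill:
THE CHART (constants `≤ A(ℓ+1)^p`, small field `r ≤ λε`), row NE3's `hleaves` (at `δ₁ = λε/2`),
`LevelSmall`, slice Poincaré, route Π's two `k`-free lines.
-/

open scoped BigOperators Matrix Matrix.Norms.L2Operator Topology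
open NormedSpace Finset Set Filter

namespace Summit.QuantumFields.BalabanUV.T4Continuum.NE7OneStepOfLocalChartRatioWideDec

open Literature.MathematicalPhysics.QuantumFieldTheory.Balaban1983to89
open B7Prop1Explicit B7Prop2Explicit MatrixLog UnitaryModel
open B4TorusKernel.MultiPeriod (torusSupNorm)
open T4AveragingDeficitWall (IsUnitaryCfg IsSkewDir SmallField vary curl curlSq dirSq dirL1)
open T4AveragingDeficitWallBoundary (IsPeriodicCfg periodBox)
open AveragingDeficitPeriodicCounting (IsPeriodicDir)
open AveragingDeficitMultiLevelPrep (LevelSmall tower TangentIter)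
open BlockAverageVaryHolo (nbRad)
open BlockAverageVaryDisc (rho0 rho0_pos)
open MinimalActionLevels (perWin)
open MinimalActionSandwich (IsMinimiser admissible)
open MinimalActionRate (sfClass)
open NE3HessForm (dAction)
open NE3SlicePoincareShape (SlicePoincare)
open NE3FrameFreeSliceW (frameFreeBlockLandauW)
open NE3TangentCovariantTower (dirIter)
open NE3DecomposedRepOfLinearNormalPart (ResidualSliceRepT)
open NE3QbarIterCovLiftPrep (cruxC)
open NE3SmoothRightInverseW (rightInvW)
open NE3RightInverseSolveLetters (thetaLoc)
open NE3RightInverseL2Letter (l2C)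
open NE3HatInvCurlLetters (curl2C curl1C curl1C_nonneg)
open B4Sect5Proof (latticeConst latticeConst_nonneg)
open B5Hk163Strip (kappa163 kappa163_pos)
open B5Hk163TorusHolderDecay (CdecD CdecD_nonneg)
open NE3EnergyShapes (IsUnitarySite)
open BlockAveragePushDirSplit (flat)
open NE7OneStepOfLocalChartWideDec (oneStep_of_dataClass_chart_routePi_wide)
open NE3EnergyWeightedShapes (energyNormW)
open NE7OneStepOfLocalChartRatio (budgetC_of_regime_ratio)
open NE7TorusRoadBudgetLetters (At_le Ab_le budgetR_of_regime growth_Y growth_Z)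
open NE7OneStepOfLocalChartRegime (tendsto_succ_pow_mul_exp_neg)
open NE7TorusRoadLine (consts_nonneg)

variable {d : ℕ} {n : Type*} [Fintype n] [DecidableEq n]

set_option maxHeartbeats 800000 in
/-- **F284cw — the small-field ONE-STEP from the local chart on the WIDE cover, regime of ratio `λ = δ/ε`.**
[Balaban1985Variational] Prop 8 ∘ [Balaban1983Laplace] Thm 2, rows NE7 ∘ NE3: F284c's statement with a free
cover factor `Kc ≥ 4ℓ + 12` (the chart hypothesis at period `N·Kc`); proof = F284c's over F283w. -/
theorem oneStep_of_chart_regime_ratio_wide [Nonempty n] {L : ℕ} [NeZero L] (hL : 2 ≤ L) {A : ℝ} (hA : 0 ≤ A) (p : ℕ)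
    {lam : ℝ} (hl0 : 0 < lam) (hl1 : lam < 1) :
    ∃ ℓ : ℕ, 1 ≤ ℓ ∧ ∃ ε₀ : ℝ, 0 < ε₀ ∧ ∀ ε : ℝ, 0 < ε → ε ≤ ε₀ → ∃ β₀ : ℝ, 0 < β₀ ∧ ∀ β : ℝ, 0 < β → β ≤ β₀ →
    ∀ (N : ℕ) [NeZero N] (Kc : ℕ) (CP C₀ C₁ αh νh κh : ℝ), 1 ≤ N → 4 * ℓ + 12 ≤ Kc → 0 < CP →
    (∀ k : ℕ, LevelSmall (d + 1) L k (ε / ((L : ℝ) ^ (k + 1)) ^ 2)) →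
    (∀ (j : ℕ) (W' : Site (d + 1) → Fin (d + 1) → (Matrix n n ℂ)ˣ), W' ∈ sfClass (d + 1) L N ε (j + 1) → SlicePoincare L (j + 1) W' (frameFreeBlockLandauW L N (j + 1) W') CP (periodBox (d := d + 1) (N * L ^ (j + 1)))) →
    -- the k-free ceilings `(α̂, ν̂, κ̂)` of the honest per-pair binder and ONE k-free strict line (F327)
    2 * κh < ((((1 / 2 - νh ^ 2) / (2 * (1 + CP)) - νh ^ 2) / 2 - 576 * ((d + 1 : ℕ) : ℝ) * (αh ^ 2 * Real.exp (2 * αh))) / (Fintype.card n : ℝ) - 28 * ((d + 1 : ℕ) : ℝ) * (ε + 7 * αh ^ 2)) →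
    -- the chart constants, polynomial in `ℓ + 1`
    0 ≤ C₀ → C₀ ≤ A * ((ℓ : ℝ) + 1) ^ p → 0 ≤ C₁ → C₁ ≤ A * ((ℓ : ℝ) + 1) ^ p →
    -- THE CHART (N1)-weak at `δ = λε`: [B8] Thm 2 at `U₀ = 1` on nested cubes, TYPE (asserted for nothing here)
    (∀ D : Site (d + 1) → Fin (d + 1) → (Matrix n n ℂ)ˣ, IsUnitaryCfg D → IsPeriodicCfg D ((N * Kc) : ℤ) → SmallField D (4 * (Real.exp β - 1)) →
      ∀ (k : ℕ), ∀ U ∈ admissible (sfClass (d + 1) L (N * Kc) ε) L (k + 1) D,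
      (∀ φ : Site (d + 1) → Fin (d + 1) → Matrix n n ℂ, IsSkewDir φ → IsPeriodicDir φ (((N * Kc) * L ^ (k + 1) : ℕ) : ℤ) → TangentIter L k U φ →
        dAction U φ (perWin (d + 1) ((N * Kc) * L ^ (k + 1))) = 0) →
      ∀ r : ℝ, 0 ≤ r → r ≤ (lam * ε) → SmallField U (r / ((L : ℝ) ^ (k + 1)) ^ 2) →
      ∀ z : Site (d + 1), ∃ (u : Site (d + 1) → (Matrix n n ℂ)ˣ) (At : Site (d + 1) → Fin (d + 1) → Matrix n n ℂ) (a₀ a₁ : ℝ),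
        IsUnitarySite u ∧ (∀ (y : Site (d + 1)) (i : Fin (d + 1)), u (y + (((N * Kc) * L ^ (k + 1) : ℕ) : ℤ) • e i) = u y) ∧
        IsSkewDir At ∧ IsPeriodicDir At (((N * Kc) * L ^ (k + 1) : ℕ) : ℤ) ∧ 0 ≤ a₀ ∧ 0 ≤ a₁ ∧
        (∀ (y : Site (d + 1)) (κ : Fin (d + 1)), ‖At y κ‖ ≤ a₀) ∧ (∀ (y : Site (d + 1)) (κ τ : Fin (d + 1)), ‖At (y + e τ) κ - At y κ‖ ≤ a₁) ∧
        (L : ℝ) ^ (k + 1) * a₀ ≤ C₀ * (r + 4 * (Real.exp β - 1) + ε) ∧ ((L : ℝ) ^ (k + 1)) ^ 2 * a₁ ≤ C₁ * (r + 4 * (Real.exp β - 1) + ε) ∧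
        (∀ (y : Site (d + 1)) (κ : Fin (d + 1)),
          torusSupNorm (fun _ : Fin (d + 1) => L ^ (k + 1) * (N * Kc)) (y - z) ≤ (((nbRad (d + 1) L + 2 * ℓ + 10) * L ^ (k + 1) : ℕ) : ℝ) →
            gaugeAct u U y κ = vary (flat (d := d + 1) (n := n)) At 1 y κ)) →
    -- THE HONEST PER-PAIR BINDER `hdecomp` on the data class at `δ₁ = λε/2` (F327's, dimension `d + 1`)
    (∀ D : Site (d + 1) → Fin (d + 1) → (Matrix n n ℂ)ˣ, IsUnitaryCfg D → IsPeriodicCfg D (N : ℤ) → SmallField D (4 * (Real.exp β - 1)) → ∀ (k : ℕ), ∀ Us ∈ admissible (sfClass (d + 1) L N ε) L (k + 1) D, SmallField Us ((lam * ε / 2) / ((L : ℝ) ^ (k + 1)) ^ 2) → (∀ φ : Site (d + 1) → Fin (d + 1) → Matrix n n ℂ, IsSkewDir φ → IsPeriodicDir φ ((N * L ^ (k + 1) : ℕ) : ℤ) → TangentIter L k Us φ → dAction Us φ (perWin (d + 1) (N * L ^ (k + 1))) = 0) → ∀ U' ∈ admissible (sfClass (d + 1) L N ε) L (k + 1) D,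 
      ∃ (u : Site (d + 1) → (Matrix n n ℂ)ˣ) (X XT XN : Site (d + 1) → Fin (d + 1) → Matrix n n ℂ) (α ν κ : ℝ),
        IsUnitarySite u ∧ IsSkewDir X ∧ IsPeriodicDir X ((N * L ^ (k + 1) : ℕ) : ℤ) ∧ 0 ≤ α ∧ (∀ x μ, ‖X x μ‖ ≤ α) ∧
        gaugeAct u U' = vary Us X 1 ∧
        X = XT + XN ∧ XT ∈ frameFreeBlockLandauW (d := d + 1) (n := n) L N (k + 1) Us ∧ IsSkewDir XN ∧ 0 ≤ ν ∧
        energyNormW L (k + 1) Us XN (periodBox (d := d + 1) (N * L ^ (k + 1)))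
          ≤ ν * energyNormW L (k + 1) Us X (periodBox (d := d + 1) (N * L ^ (k + 1))) ∧
        ε / ((L : ℝ) ^ (k + 1)) ^ 2 * (∑ p ∈ perWin (d + 1) (N * L ^ (k + 1)), ‖curl Us XN p‖)
          ≤ κ * energyNormW L (k + 1) Us X (periodBox (d := d + 1) (N * L ^ (k + 1))) ^ 2 ∧
        α * (L : ℝ) ^ (k + 1) ≤ αh ∧ ν ≤ νh ∧ κ ≤ κh) →
    ∃ γ : ℝ, 0 < γ ∧ ∀ V : Site (d + 1) → Fin (d + 1) → (Matrix n n ℂ)ˣ, IsUnitaryCfg V → IsPeriodicCfg V (N : ℤ) → SmallField V γ →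
      ∀ (k : ℕ) (U₀ : Site (d + 1) → Fin (d + 1) → (Matrix n n ℂ)ˣ), U₀ ∈ admissible (sfClass (d + 1) L N ε) L (k + 1) V →
        SmallField U₀ ((lam * ε) / ((L : ℝ) ^ k) ^ 2) →
        ∃ U, IsMinimiser (d + 1) (sfClass (d + 1) L N ε) L N (k + 1) V U ∧ SmallField U ((lam * ε) / ((L : ℝ) ^ (k + 1)) ^ 2) := by
  obtain ⟨K, c, hK, hc, hF⟩ := oneStep_of_dataClass_chart_routePi_wide (d := d) (n := n) hL
  obtain ⟨hKd0, hCg0, hK30, hK40, hD0, -⟩ := consts_nonneg (d := d) L 0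
  have hcP0 : (0 : ℝ) ≤ (Fintype.card (T4AveragingDeficitWall.Plane (d + 1)) : ℝ) := Nat.cast_nonneg _
  have hnF0 : (0 : ℝ) ≤ (Fintype.card n : ℝ) := Nat.cast_nonneg _
  have hCd0 : (0 : ℝ) ≤ CdecD d := CdecD_nonneg
  have hkap : (0 : ℝ) < kappa163 (d + 1) / (d + 1) / 2 := by have := kappa163_pos (d + 1); positivity
  have hlc0 : (0 : ℝ) ≤ latticeConst (d + 1) (kappa163 (d + 1) / (d + 1) / 2) := latticeConst_nonneg _ hkap.le
  have hcurl : (0 : ℝ) ≤ curl1C (d + 1) L := curl1C_nonneg _ _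
  have hCcs0 : (0 : ℝ) ≤ (2 * curl1C (d + 1) L) := mul_nonneg zero_le_two hcurl
  have hρ : (0 : ℝ) < rho0 (d + 1) L := rho0_pos (d := d + 1) (le_trans one_le_two hL)
  have hA1 : (0 : ℝ) ≤ A + 1 := by linarith only [hA]
  have hL0 : (0 : ℝ) ≤ (L : ℝ) := Nat.cast_nonneg _
  have hD10 : (0 : ℝ) ≤ (((d + 1 : ℕ) : ℝ) + 1) := by positivity
  -- the two growth constants and the two decays
  have hQb00 : (0 : ℝ) ≤ (28 * ((3 + 12 * ((d + 1 : ℕ) : ℝ)) + (4 * (3 + 12 * ((d + 1 : ℕ) : ℝ)) ^ 3 / rho0 (d + 1) L ^ 2) * (A + 1)) ^ 2 + 4 * (4 * (3 + 12 * ((d + 1 : ℕ) : ℝ)) ^ 3 / rho0 (d + 1) L ^ 2)) := add_nonneg (mul_nonneg (by norm_num) (sq_nonneg _)) (mul_nonneg (by norm_num) hK40)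
  have hY0 : (0 : ℝ) ≤ (K * (2 * curl1C (d + 1) L) + 8 * K * (Fintype.card (T4AveragingDeficitWall.Plane (d + 1)) : ℝ) * (A + 1)) :=
    add_nonneg (mul_nonneg hK hCcs0) (mul_nonneg (mul_nonneg (mul_nonneg (by norm_num) hK) hcP0) hA1)
  have hZ0 : (0 : ℝ) ≤ (2 * (Fintype.card n : ℝ) * CdecD d * ((d : ℝ) + 1) * latticeConst (d + 1) (kappa163 (d + 1) / (d + 1) / 2) * ((3 + 12 * ((d + 1 : ℕ) : ℝ)) * (A + 1) + ((d : ℝ) + 1) * 6 * (2 * (3 + 12 * ((d + 1 : ℕ) : ℝ)) * (A + 1) + (28 * ((3 + 12 * ((d + 1 : ℕ) : ℝ)) + (4 * (3 + 12 * ((d + 1 : ℕ) : ℝ)) ^ 3 / rho0 (d + 1) L ^ 2) * (A + 1)) ^ 2 + 4 * (4 * (3 + 12 * ((d + 1 : ℕ) : ℝ)) ^ 3 / rho0 (d + 1) L ^ 2)) * (A + 1) ^ 2))) :=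
    mul_nonneg (mul_nonneg (mul_nonneg (mul_nonneg (mul_nonneg zero_le_two hnF0) hCd0) hD0) hlc0)
      (add_nonneg (mul_nonneg hK30 hA1) (mul_nonneg (mul_nonneg hD0 (by norm_num))
        (add_nonneg (mul_nonneg (mul_nonneg zero_le_two hK30) hA1) (mul_nonneg hQb00 (pow_nonneg hA1 2)))))
  have hηY : (0 : ℝ) < lam / (72 * ((K * (2 * curl1C (d + 1) L) + 8 * K * (Fintype.card (T4AveragingDeficitWall.Plane (d + 1)) : ℝ) * (A + 1)) + 1)) := div_pos hl0 (by linarith only [hY0])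
  have hηZ : (0 : ℝ) < lam / (72 * ((2 * (Fintype.card n : ℝ) * CdecD d * ((d : ℝ) + 1) * latticeConst (d + 1) (kappa163 (d + 1) / (d + 1) / 2) * ((3 + 12 * ((d + 1 : ℕ) : ℝ)) * (A + 1) + ((d : ℝ) + 1) * 6 * (2 * (3 + 12 * ((d + 1 : ℕ) : ℝ)) * (A + 1) + (28 * ((3 + 12 * ((d + 1 : ℕ) : ℝ)) + (4 * (3 + 12 * ((d + 1 : ℕ) : ℝ)) ^ 3 / rho0 (d + 1) L ^ 2) * (A + 1)) ^ 2 + 4 * (4 * (3 + 12 * ((d + 1 : ℕ) : ℝ)) ^ 3 / rho0 (d + 1) L ^ 2)) * (A + 1) ^ 2))) + 1)) := div_pos hl0 (by linarith only [hZ0])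
  have eY := (tendsto_succ_pow_mul_exp_neg p hc).eventually_le_const hηY
  have eZ := (tendsto_succ_pow_mul_exp_neg (4 * p + 1) hkap).eventually_le_const hηZ
  obtain ⟨ℓ, hℓ1, hℓu, hℓv⟩ := ((eventually_ge_atTop 1).and (eY.and eZ)).exists
  -- the cube parameter `ℓ`
  refine ⟨ℓ, hℓ1, ?_⟩
  have hℓr : (1 : ℝ) ≤ (ℓ : ℝ) := Nat.one_le_cast.mpr hℓ1
  have hx1 : (1 : ℝ) ≤ ((ℓ : ℝ) + 1) := by linarith only [hℓr]
  have hx0 : (0 : ℝ) ≤ ((ℓ : ℝ) + 1) := by linarith only [hℓr]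
  have hlq0 : (0 : ℝ) ≤ (4 * ((ℓ + 1 : ℕ) : ℝ) + 2) := by positivity
  have hlqx : (4 * ((ℓ + 1 : ℕ) : ℝ) + 2) ≤ 6 * ((ℓ : ℝ) + 1) := by push_cast; linarith only [hℓr]
  have hxp0 : (0 : ℝ) ≤ ((ℓ : ℝ) + 1) ^ p := pow_nonneg hx0 p
  have hec0 : (0 : ℝ) ≤ Real.exp (-(c * ℓ)) := (Real.exp_pos _).le
  have hec1 : Real.exp (-(c * ℓ)) ≤ 1 := Real.exp_le_one_iff.mpr (neg_nonpos.mpr (mul_nonneg hc.le (Nat.cast_nonneg ℓ)))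
  have hek0 : (0 : ℝ) ≤ Real.exp (-(kappa163 (d + 1) / (d + 1) / 2 * ℓ)) := (Real.exp_pos _).le
  have hek1 : Real.exp (-(kappa163 (d + 1) / (d + 1) / 2 * ℓ)) ≤ 1 := Real.exp_le_one_iff.mpr (neg_nonpos.mpr (mul_nonneg hkap.le (Nat.cast_nonneg ℓ)))
  -- growth bounds at `ℓ` (explicit forms), then LETTERS for the big constants
  have aY := mul_le_mul_of_nonneg_left (growth_Y (p := p) (A := A) hK hCcs0 hcP0 hx1) hec0
  have aZ := mul_le_mul_of_nonneg_left (growth_Z (p := p) hK30 hK40 hCd0 hD0 hlc0 hnF0 hA hx1 hlqx) hek0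
  obtain ⟨Cb, hCb⟩ : ∃ t : ℝ, t = (A * ((ℓ : ℝ) + 1) ^ p + 1) := ⟨_, rfl⟩
  rw [← hCb] at aY aZ
  have hCb1 : (1 : ℝ) ≤ Cb := by rw [hCb]; exact le_add_of_nonneg_left (mul_nonneg hA hxp0)
  have hCb0 : (0 : ℝ) ≤ Cb := zero_le_one.trans hCb1
  have hQb0 : (0 : ℝ) ≤ (28 * ((3 + 12 * ((d + 1 : ℕ) : ℝ)) + (4 * (3 + 12 * ((d + 1 : ℕ) : ℝ)) ^ 3 / rho0 (d + 1) L ^ 2) * Cb) ^ 2 + 4 * (4 * (3 + 12 * ((d + 1 : ℕ) : ℝ)) ^ 3 / rho0 (d + 1) L ^ 2)) :=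
    add_nonneg (mul_nonneg (by norm_num) (sq_nonneg _)) (mul_nonneg (by norm_num) hK40)
  obtain ⟨Xs, hXs⟩ : ∃ t : ℝ, t = (4 * K * (2 * curl1C (d + 1) L) * (8 * (3 + 12 * ((d + 1 : ℕ) : ℝ)) * (2 + 2 * ((((d + 1 : ℕ) : ℝ) + 1) * L)
        * (1 + ((1250 * ((nbRad (d + 1) L : ℝ) + L) + 8 * (((d + 1 : ℕ) : ℝ) * L) + 2 * L) * (((d + 1 : ℕ) : ℝ) * (2 * nbRad (d + 1) L + 1) ^ (d + 1)))
          / ((L : ℝ) / (L : ℝ) ^ (d + 1))))) * Cb + (53392 * K * (Fintype.card (T4AveragingDeficitWall.Plane (d + 1)) : ℝ) * Cb ^ 4 + (Fintype.card n : ℝ) * (2 * (CdecD d * (((d : ℝ) + 1) * (2 * ((d : ℝ) + 1))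
              * ((2 + 32 / (kappa163 (d + 1) / (d + 1)) ^ 2) * latticeConst (d + 1) (kappa163 (d + 1) / (d + 1) / 2))))) * (1 + 12 * ((d : ℝ) + 1)) * (28 * ((3 + 12 * ((d + 1 : ℕ) : ℝ)) + (4 * (3 + 12 * ((d + 1 : ℕ) : ℝ)) ^ 3 / rho0 (d + 1) L ^ 2) * Cb) ^ 2 + 4 * (4 * (3 + 12 * ((d + 1 : ℕ) : ℝ)) ^ 3 / rho0 (d + 1) L ^ 2)) * Cb ^ 2 + 28 * Cb ^ 2)) := ⟨_, rfl⟩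
  obtain ⟨Z, hZ⟩ : ∃ t : ℝ, t = (2 * (Fintype.card n : ℝ) * CdecD d * ((d : ℝ) + 1) * latticeConst (d + 1) (kappa163 (d + 1) / (d + 1) / 2) * ((3 + 12 * ((d + 1 : ℕ) : ℝ)) * Cb + ((d : ℝ) + 1) * (4 * ((ℓ + 1 : ℕ) : ℝ) + 2) * (2 * (3 + 12 * ((d + 1 : ℕ) : ℝ)) * Cb + (28 * ((3 + 12 * ((d + 1 : ℕ) : ℝ)) + (4 * (3 + 12 * ((d + 1 : ℕ) : ℝ)) ^ 3 / rho0 (d + 1) L ^ 2) * Cb) ^ 2 + 4 * (4 * (3 + 12 * ((d + 1 : ℕ) : ℝ)) ^ 3 / rho0 (d + 1) L ^ 2)) * Cb ^ 2))) := ⟨_, rfl⟩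
  obtain ⟨G, hG⟩ : ∃ t : ℝ, t = ((Fintype.card n : ℝ) * (2 * (CdecD d * (((d : ℝ) + 1) * (2 * ((d : ℝ) + 1))
              * ((2 + 32 / (kappa163 (d + 1) / (d + 1)) ^ 2) * latticeConst (d + 1) (kappa163 (d + 1) / (d + 1) / 2))))) * (1 + 12 * ((d : ℝ) + 1)) + 2 * (Fintype.card n : ℝ) * CdecD d * ((d : ℝ) + 1) * ((d : ℝ) + 1) * latticeConst (d + 1) (kappa163 (d + 1) / (d + 1) / 2) * (4 * ((ℓ + 1 : ℕ) : ℝ) + 2)) := ⟨_, rfl⟩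
  rw [← hZ] at aZ
  have hXs0 : (0 : ℝ) ≤ Xs := by
    rw [hXs]
    exact add_nonneg (mul_nonneg (mul_nonneg (mul_nonneg (mul_nonneg (by norm_num) hK) hCcs0) hKd0) hCb0)
      (add_nonneg (add_nonneg (mul_nonneg (mul_nonneg (mul_nonneg (by norm_num) hK) hcP0) (pow_nonneg hCb0 4))
        (mul_nonneg (mul_nonneg (mul_nonneg (mul_nonneg hnF0 hCg0) (by linarith only [hD0])) hQb0) (pow_nonneg hCb0 2)))
        (mul_nonneg (by norm_num) (pow_nonneg hCb0 2)))
  have hGB0 : (0 : ℝ) ≤ G := by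
    rw [hG]
    exact add_nonneg (mul_nonneg (mul_nonneg hnF0 hCg0) (by linarith only [hD0]))
      (mul_nonneg (mul_nonneg (mul_nonneg (mul_nonneg (mul_nonneg (mul_nonneg zero_le_two hnF0) hCd0) hD0) hD0) hlc0) hlq0)
  have hYx : Real.exp (-(c * ℓ)) * (K * (2 * curl1C (d + 1) L) + 8 * K * (Fintype.card (T4AveragingDeficitWall.Plane (d + 1)) : ℝ) * Cb) ≤ lam / 72 := by
    have b := mul_le_mul_of_nonneg_left hℓu hY0
    have c' : (K * (2 * curl1C (d + 1) L) + 8 * K * (Fintype.card (T4AveragingDeficitWall.Plane (d + 1)) : ℝ) * (A + 1)) * (lam / (72 * ((K * (2 * curl1C (d + 1) L) + 8 * K * (Fintype.card (T4AveragingDeficitWall.Plane (d + 1)) : ℝ) * (A + 1)) + 1))) ≤ lam / 72 := by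
      rw [← mul_div_assoc, div_le_div_iff₀ (by linarith only [hY0]) (by norm_num)]; nlinarith only [hY0, hl0]
    linarith only [aY, b, c']
  have hZx : Real.exp (-(kappa163 (d + 1) / (d + 1) / 2 * ℓ)) * Z ≤ lam / 72 := by
    have b := mul_le_mul_of_nonneg_left hℓv hZ0
    have c' : (2 * (Fintype.card n : ℝ) * CdecD d * ((d : ℝ) + 1) * latticeConst (d + 1) (kappa163 (d + 1) / (d + 1) / 2) * ((3 + 12 * ((d + 1 : ℕ) : ℝ)) * (A + 1) + ((d : ℝ) + 1) * 6 * (2 * (3 + 12 * ((d + 1 : ℕ) : ℝ)) * (A + 1) + (28 * ((3 + 12 * ((d + 1 : ℕ) : ℝ)) + (4 * (3 + 12 * ((d + 1 : ℕ) : ℝ)) ^ 3 / rho0 (d + 1) L ^ 2) * (A + 1)) ^ 2 + 4 * (4 * (3 + 12 * ((d + 1 : ℕ) : ℝ)) ^ 3 / rho0 (d + 1) L ^ 2)) * (A + 1) ^ 2))) * (lam / (72 * ((2 * (Fintype.card n : ℝ) * CdecD d * ((d : ℝ) + 1) * latticeConst (d + 1) (kappa163 (d + 1) / (d + 1) / 2)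 * ((3 + 12 * ((d + 1 : ℕ) : ℝ)) * (A + 1) + ((d : ℝ) + 1) * 6 * (2 * (3 + 12 * ((d + 1 : ℕ) : ℝ)) * (A + 1) + (28 * ((3 + 12 * ((d + 1 : ℕ) : ℝ)) + (4 * (3 + 12 * ((d + 1 : ℕ) : ℝ)) ^ 3 / rho0 (d + 1) L ^ 2) * (A + 1)) ^ 2 + 4 * (4 * (3 + 12 * ((d + 1 : ℕ) : ℝ)) ^ 3 / rho0 (d + 1) L ^ 2)) * (A + 1) ^ 2))) + 1))) ≤ lam / 72 := by
      rw [← mul_div_assoc, div_le_div_iff₀ (by linarith only [hZ0]) (by norm_num)]; nlinarith only [hZ0, hl0]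
    linarith only [aZ, b, c']
  -- `ε₀ = 1 / M`
  have n2 : (0 : ℝ) ≤ 3 := by norm_num
  have nCb2 : (0 : ℝ) ≤ 3 * Cb := by linarith only [hCb0]
  have nρ : (0 : ℝ) ≤ 12 * (3 + 12 * ((d + 1 : ℕ) : ℝ)) ^ 2 * Cb / rho0 (d + 1) L ^ 2 :=
    div_nonneg (mul_nonneg (mul_nonneg (by norm_num) (sq_nonneg _)) hCb0) (sq_nonneg _)
  have nKd : (0 : ℝ) ≤ 3 * (8 * (3 + 12 * ((d + 1 : ℕ) : ℝ)) * (2 + 2 * ((((d + 1 : ℕ) : ℝ) + 1) * L)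
        * (1 + ((1250 * ((nbRad (d + 1) L : ℝ) + L) + 8 * (((d + 1 : ℕ) : ℝ) * L) + 2 * L) * (((d + 1 : ℕ) : ℝ) * (2 * nbRad (d + 1) L + 1) ^ (d + 1)))
          / ((L : ℝ) / (L : ℝ) ^ (d + 1))))) * Cb := mul_nonneg (mul_nonneg (by norm_num) hKd0) hCb0
  have nD1 : (0 : ℝ) ≤ 768 * (((d + 1 : ℕ) : ℝ) + 1) * L * (3 + 12 * ((d + 1 : ℕ) : ℝ)) * Cb :=
    mul_nonneg (mul_nonneg (mul_nonneg (mul_nonneg (by norm_num) hD10) hL0) hK30) hCb0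
  have nθ : (0 : ℝ) ≤ 2 * |thetaLoc (d + 1) L| := mul_nonneg zero_le_two (abs_nonneg _)
  have nX : (0 : ℝ) ≤ 216 * Xs / lam := div_nonneg (mul_nonneg (by norm_num) hXs0) hl0.le
  have ncx : (0 : ℝ) ≤ |cruxC (d + 1) L| + 1 := by linarith only [abs_nonneg (cruxC (d + 1) L)]
  have nc0 : (0 : ℝ) ≤ 6 * |C0 (d + 1)| := mul_nonneg (by norm_num) (abs_nonneg _)
  have nH2 : (0 : ℝ) ≤ 1024 * (((d + 1 : ℕ) : ℝ) + 1) * (((d + 1 : ℕ) : ℝ) + 4) * (L : ℝ) ^ 2 := mul_nonneg (mul_nonneg (mul_nonneg (by norm_num) hD10) (by positivity)) (sq_nonneg _)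
  have hM : (0 : ℝ) < (3 + 3 * Cb + 12 * (3 + 12 * ((d + 1 : ℕ) : ℝ)) ^ 2 * Cb / rho0 (d + 1) L ^ 2 + 3 * (8 * (3 + 12 * ((d + 1 : ℕ) : ℝ)) * (2 + 2 * ((((d + 1 : ℕ) : ℝ) + 1) * L)
        * (1 + ((1250 * ((nbRad (d + 1) L : ℝ) + L) + 8 * (((d + 1 : ℕ) : ℝ) * L) + 2 * L) * (((d + 1 : ℕ) : ℝ) * (2 * nbRad (d + 1) L + 1) ^ (d + 1)))
          / ((L : ℝ) / (L : ℝ) ^ (d + 1))))) * Cb + 768 * (((d + 1 : ℕ) : ℝ) + 1) * L * (3 + 12 * ((d + 1 : ℕ) : ℝ)) * Cb + 2 * |thetaLoc (d + 1) L| + 216 * Xs / lam + |cruxC (d + 1) L| + 6 * |C0 (d + 1)| + 1024 * (((d + 1 : ℕ) : ℝ) + 1) * (((d + 1 : ℕ) : ℝ) + 4) * (L : ℝ) ^ 2 + 1) := by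
    linarith only [n2, nCb2, nρ, nKd, nD1, nθ, nX, ncx, nc0, nH2]
  refine ⟨1 / (3 + 3 * Cb + 12 * (3 + 12 * ((d + 1 : ℕ) : ℝ)) ^ 2 * Cb / rho0 (d + 1) L ^ 2 + 3 * (8 * (3 + 12 * ((d + 1 : ℕ) : ℝ)) * (2 + 2 * ((((d + 1 : ℕ) : ℝ) + 1) * L)
        * (1 + ((1250 * ((nbRad (d + 1) L : ℝ) + L) + 8 * (((d + 1 : ℕ) : ℝ) * L) + 2 * L) * (((d + 1 : ℕ) : ℝ) * (2 * nbRad (d + 1) L + 1) ^ (d + 1)))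
          / ((L : ℝ) / (L : ℝ) ^ (d + 1))))) * Cb + 768 * (((d + 1 : ℕ) : ℝ) + 1) * L * (3 + 12 * ((d + 1 : ℕ) : ℝ)) * Cb + 2 * |thetaLoc (d + 1) L| + 216 * Xs / lam + |cruxC (d + 1) L| + 6 * |C0 (d + 1)| + 1024 * (((d + 1 : ℕ) : ℝ) + 1) * (((d + 1 : ℕ) : ℝ) + 4) * (L : ℝ) ^ 2 + 1), div_pos one_pos hM, ?_⟩
  intro ε hε hεle
  have hεM : ε * (3 + 3 * Cb + 12 * (3 + 12 * ((d + 1 : ℕ) : ℝ)) ^ 2 * Cb / rho0 (d + 1) L ^ 2 + 3 * (8 * (3 + 12 * ((d + 1 : ℕ) : ℝ)) * (2 + 2 * ((((d + 1 : ℕ) : ℝ) + 1) * L)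
        * (1 + ((1250 * ((nbRad (d + 1) L : ℝ) + L) + 8 * (((d + 1 : ℕ) : ℝ) * L) + 2 * L) * (((d + 1 : ℕ) : ℝ) * (2 * nbRad (d + 1) L + 1) ^ (d + 1)))
          / ((L : ℝ) / (L : ℝ) ^ (d + 1))))) * Cb + 768 * (((d + 1 : ℕ) : ℝ) + 1) * L * (3 + 12 * ((d + 1 : ℕ) : ℝ)) * Cb + 2 * |thetaLoc (d + 1) L| + 216 * Xs / lam + |cruxC (d + 1) L| + 6 * |C0 (d + 1)| + 1024 * (((d + 1 : ℕ) : ℝ) + 1) * (((d + 1 : ℕ) : ℝ) + 4) * (L : ℝ) ^ 2 + 1) ≤ 1 := (le_div_iff₀ hM).mp hεle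
  have q2 : ε * (3) ≤ 1 :=
    (mul_le_mul_of_nonneg_left (show 3 ≤ (3 + 3 * Cb + 12 * (3 + 12 * ((d + 1 : ℕ) : ℝ)) ^ 2 * Cb / rho0 (d + 1) L ^ 2 + 3 * (8 * (3 + 12 * ((d + 1 : ℕ) : ℝ)) * (2 + 2 * ((((d + 1 : ℕ) : ℝ) + 1) * L)
        * (1 + ((1250 * ((nbRad (d + 1) L : ℝ) + L) + 8 * (((d + 1 : ℕ) : ℝ) * L) + 2 * L) * (((d + 1 : ℕ) : ℝ) * (2 * nbRad (d + 1) L + 1) ^ (d + 1)))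
          / ((L : ℝ) / (L : ℝ) ^ (d + 1))))) * Cb + 768 * (((d + 1 : ℕ) : ℝ) + 1) * L * (3 + 12 * ((d + 1 : ℕ) : ℝ)) * Cb + 2 * |thetaLoc (d + 1) L| + 216 * Xs / lam + |cruxC (d + 1) L| + 6 * |C0 (d + 1)| + 1024 * (((d + 1 : ℕ) : ℝ) + 1) * (((d + 1 : ℕ) : ℝ) + 4) * (L : ℝ) ^ 2 + 1) by linarith only [n2, nCb2, nρ, nKd, nD1, nθ, nX, ncx, nc0, nH2]) hε.le).trans hεM
  have qCb : ε * (3 * Cb) ≤ 1 :=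
    (mul_le_mul_of_nonneg_left (show 3 * Cb ≤ (3 + 3 * Cb + 12 * (3 + 12 * ((d + 1 : ℕ) : ℝ)) ^ 2 * Cb / rho0 (d + 1) L ^ 2 + 3 * (8 * (3 + 12 * ((d + 1 : ℕ) : ℝ)) * (2 + 2 * ((((d + 1 : ℕ) : ℝ) + 1) * L)
        * (1 + ((1250 * ((nbRad (d + 1) L : ℝ) + L) + 8 * (((d + 1 : ℕ) : ℝ) * L) + 2 * L) * (((d + 1 : ℕ) : ℝ) * (2 * nbRad (d + 1) L + 1) ^ (d + 1)))
          / ((L : ℝ) / (L : ℝ) ^ (d + 1))))) * Cb + 768 * (((d + 1 : ℕ) : ℝ) + 1) * L * (3 + 12 * ((d + 1 : ℕ) : ℝ)) * Cb + 2 * |thetaLoc (d + 1) L| + 216 * Xs / lam + |cruxC (d + 1) L| + 6 * |C0 (d + 1)| + 1024 * (((d + 1 : ℕ) : ℝ) + 1) * (((d + 1 : ℕ) : ℝ) + 4) * (L : ℝ) ^ 2 + 1) by linarith only [n2, nCb2, nρ, nKd, nD1, nθ, nX, ncx, nc0, nH2]) hε.le).trans hεM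
  have qρ : ε * (12 * (3 + 12 * ((d + 1 : ℕ) : ℝ)) ^ 2 * Cb / rho0 (d + 1) L ^ 2) ≤ 1 :=
    (mul_le_mul_of_nonneg_left (show 12 * (3 + 12 * ((d + 1 : ℕ) : ℝ)) ^ 2 * Cb / rho0 (d + 1) L ^ 2 ≤ (3 + 3 * Cb + 12 * (3 + 12 * ((d + 1 : ℕ) : ℝ)) ^ 2 * Cb / rho0 (d + 1) L ^ 2 + 3 * (8 * (3 + 12 * ((d + 1 : ℕ) : ℝ)) * (2 + 2 * ((((d + 1 : ℕ) : ℝ) + 1) * L)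
        * (1 + ((1250 * ((nbRad (d + 1) L : ℝ) + L) + 8 * (((d + 1 : ℕ) : ℝ) * L) + 2 * L) * (((d + 1 : ℕ) : ℝ) * (2 * nbRad (d + 1) L + 1) ^ (d + 1)))
          / ((L : ℝ) / (L : ℝ) ^ (d + 1))))) * Cb + 768 * (((d + 1 : ℕ) : ℝ) + 1) * L * (3 + 12 * ((d + 1 : ℕ) : ℝ)) * Cb + 2 * |thetaLoc (d + 1) L| + 216 * Xs / lam + |cruxC (d + 1) L| + 6 * |C0 (d + 1)| + 1024 * (((d + 1 : ℕ) : ℝ) + 1) * (((d + 1 : ℕ) : ℝ) + 4) * (L : ℝ) ^ 2 + 1) by linarith only [n2, nCb2, nρ, nKd, nD1, nθ, nX, ncx, nc0, nH2]) hε.le).trans hεM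
  have qKd : ε * (3 * (8 * (3 + 12 * ((d + 1 : ℕ) : ℝ)) * (2 + 2 * ((((d + 1 : ℕ) : ℝ) + 1) * L)
        * (1 + ((1250 * ((nbRad (d + 1) L : ℝ) + L) + 8 * (((d + 1 : ℕ) : ℝ) * L) + 2 * L) * (((d + 1 : ℕ) : ℝ) * (2 * nbRad (d + 1) L + 1) ^ (d + 1)))
          / ((L : ℝ) / (L : ℝ) ^ (d + 1))))) * Cb) ≤ 1 :=
    (mul_le_mul_of_nonneg_left (show 3 * (8 * (3 + 12 * ((d + 1 : ℕ) : ℝ)) * (2 + 2 * ((((d + 1 : ℕ) : ℝ) + 1) * L)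
        * (1 + ((1250 * ((nbRad (d + 1) L : ℝ) + L) + 8 * (((d + 1 : ℕ) : ℝ) * L) + 2 * L) * (((d + 1 : ℕ) : ℝ) * (2 * nbRad (d + 1) L + 1) ^ (d + 1)))
          / ((L : ℝ) / (L : ℝ) ^ (d + 1))))) * Cb ≤ (3 + 3 * Cb + 12 * (3 + 12 * ((d + 1 : ℕ) : ℝ)) ^ 2 * Cb / rho0 (d + 1) L ^ 2 + 3 * (8 * (3 + 12 * ((d + 1 : ℕ) : ℝ)) * (2 + 2 * ((((d + 1 : ℕ) : ℝ) + 1) * L)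
        * (1 + ((1250 * ((nbRad (d + 1) L : ℝ) + L) + 8 * (((d + 1 : ℕ) : ℝ) * L) + 2 * L) * (((d + 1 : ℕ) : ℝ) * (2 * nbRad (d + 1) L + 1) ^ (d + 1)))
          / ((L : ℝ) / (L : ℝ) ^ (d + 1))))) * Cb + 768 * (((d + 1 : ℕ) : ℝ) + 1) * L * (3 + 12 * ((d + 1 : ℕ) : ℝ)) * Cb + 2 * |thetaLoc (d + 1) L| + 216 * Xs / lam + |cruxC (d + 1) L| + 6 * |C0 (d + 1)| + 1024 * (((d + 1 : ℕ) : ℝ) + 1) * (((d + 1 : ℕ) : ℝ) + 4) * (L : ℝ) ^ 2 + 1) by linarith only [n2, nCb2, nρ, nKd, nD1, nθ, nX, ncx, nc0, nH2]) hε.le).trans hεM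
  have qD1 : ε * (768 * (((d + 1 : ℕ) : ℝ) + 1) * L * (3 + 12 * ((d + 1 : ℕ) : ℝ)) * Cb) ≤ 1 :=
    (mul_le_mul_of_nonneg_left (show 768 * (((d + 1 : ℕ) : ℝ) + 1) * L * (3 + 12 * ((d + 1 : ℕ) : ℝ)) * Cb ≤ (3 + 3 * Cb + 12 * (3 + 12 * ((d + 1 : ℕ) : ℝ)) ^ 2 * Cb / rho0 (d + 1) L ^ 2 + 3 * (8 * (3 + 12 * ((d + 1 : ℕ) : ℝ)) * (2 + 2 * ((((d + 1 : ℕ) : ℝ) + 1) * L)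
        * (1 + ((1250 * ((nbRad (d + 1) L : ℝ) + L) + 8 * (((d + 1 : ℕ) : ℝ) * L) + 2 * L) * (((d + 1 : ℕ) : ℝ) * (2 * nbRad (d + 1) L + 1) ^ (d + 1)))
          / ((L : ℝ) / (L : ℝ) ^ (d + 1))))) * Cb + 768 * (((d + 1 : ℕ) : ℝ) + 1) * L * (3 + 12 * ((d + 1 : ℕ) : ℝ)) * Cb + 2 * |thetaLoc (d + 1) L| + 216 * Xs / lam + |cruxC (d + 1) L| + 6 * |C0 (d + 1)| + 1024 * (((d + 1 : ℕ) : ℝ) + 1) * (((d + 1 : ℕ) : ℝ) + 4) * (L : ℝ) ^ 2 + 1) by linarith only [n2, nCb2, nρ, nKd, nD1, nθ, nX, ncx, nc0, nH2]) hε.le).trans hεM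
  have qθ : ε * (2 * |thetaLoc (d + 1) L|) ≤ 1 :=
    (mul_le_mul_of_nonneg_left (show 2 * |thetaLoc (d + 1) L| ≤ (3 + 3 * Cb + 12 * (3 + 12 * ((d + 1 : ℕ) : ℝ)) ^ 2 * Cb / rho0 (d + 1) L ^ 2 + 3 * (8 * (3 + 12 * ((d + 1 : ℕ) : ℝ)) * (2 + 2 * ((((d + 1 : ℕ) : ℝ) + 1) * L)
        * (1 + ((1250 * ((nbRad (d + 1) L : ℝ) + L) + 8 * (((d + 1 : ℕ) : ℝ) * L) + 2 * L) * (((d + 1 : ℕ) : ℝ) * (2 * nbRad (d + 1) L + 1) ^ (d + 1)))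
          / ((L : ℝ) / (L : ℝ) ^ (d + 1))))) * Cb + 768 * (((d + 1 : ℕ) : ℝ) + 1) * L * (3 + 12 * ((d + 1 : ℕ) : ℝ)) * Cb + 2 * |thetaLoc (d + 1) L| + 216 * Xs / lam + |cruxC (d + 1) L| + 6 * |C0 (d + 1)| + 1024 * (((d + 1 : ℕ) : ℝ) + 1) * (((d + 1 : ℕ) : ℝ) + 4) * (L : ℝ) ^ 2 + 1) by linarith only [n2, nCb2, nρ, nKd, nD1, nθ, nX, ncx, nc0, nH2]) hε.le).trans hεM
  have qX : ε * (216 * Xs / lam) ≤ 1 :=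
    (mul_le_mul_of_nonneg_left (show 216 * Xs / lam ≤ (3 + 3 * Cb + 12 * (3 + 12 * ((d + 1 : ℕ) : ℝ)) ^ 2 * Cb / rho0 (d + 1) L ^ 2 + 3 * (8 * (3 + 12 * ((d + 1 : ℕ) : ℝ)) * (2 + 2 * ((((d + 1 : ℕ) : ℝ) + 1) * L)
        * (1 + ((1250 * ((nbRad (d + 1) L : ℝ) + L) + 8 * (((d + 1 : ℕ) : ℝ) * L) + 2 * L) * (((d + 1 : ℕ) : ℝ) * (2 * nbRad (d + 1) L + 1) ^ (d + 1)))
          / ((L : ℝ) / (L : ℝ) ^ (d + 1))))) * Cb + 768 * (((d + 1 : ℕ) : ℝ) + 1) * L * (3 + 12 * ((d + 1 : ℕ) : ℝ)) * Cb + 2 * |thetaLoc (d + 1) L| + 216 * Xs / lam + |cruxC (d + 1) L| + 6 * |C0 (d + 1)| + 1024 * (((d + 1 : ℕ) : ℝ) + 1) * (((d + 1 : ℕ) : ℝ) + 4) * (L : ℝ) ^ 2 + 1) by linarith only [n2, nCb2, nρ, nKd, nD1, nθ, nX, ncx, nc0, nH2]) hε.le).trans hεM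
  have qcx : ε * (|cruxC (d + 1) L| + 1) ≤ 1 :=
    (mul_le_mul_of_nonneg_left (show |cruxC (d + 1) L| + 1 ≤ (3 + 3 * Cb + 12 * (3 + 12 * ((d + 1 : ℕ) : ℝ)) ^ 2 * Cb / rho0 (d + 1) L ^ 2 + 3 * (8 * (3 + 12 * ((d + 1 : ℕ) : ℝ)) * (2 + 2 * ((((d + 1 : ℕ) : ℝ) + 1) * L)
        * (1 + ((1250 * ((nbRad (d + 1) L : ℝ) + L) + 8 * (((d + 1 : ℕ) : ℝ) * L) + 2 * L) * (((d + 1 : ℕ) : ℝ) * (2 * nbRad (d + 1) L + 1) ^ (d + 1)))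
          / ((L : ℝ) / (L : ℝ) ^ (d + 1))))) * Cb + 768 * (((d + 1 : ℕ) : ℝ) + 1) * L * (3 + 12 * ((d + 1 : ℕ) : ℝ)) * Cb + 2 * |thetaLoc (d + 1) L| + 216 * Xs / lam + |cruxC (d + 1) L| + 6 * |C0 (d + 1)| + 1024 * (((d + 1 : ℕ) : ℝ) + 1) * (((d + 1 : ℕ) : ℝ) + 4) * (L : ℝ) ^ 2 + 1) by linarith only [n2, nCb2, nρ, nKd, nD1, nθ, nX, ncx, nc0, nH2]) hε.le).trans hεM
  have qc0 : ε * (6 * |C0 (d + 1)|) ≤ 1 :=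
    (mul_le_mul_of_nonneg_left (show 6 * |C0 (d + 1)| ≤ (3 + 3 * Cb + 12 * (3 + 12 * ((d + 1 : ℕ) : ℝ)) ^ 2 * Cb / rho0 (d + 1) L ^ 2 + 3 * (8 * (3 + 12 * ((d + 1 : ℕ) : ℝ)) * (2 + 2 * ((((d + 1 : ℕ) : ℝ) + 1) * L)
        * (1 + ((1250 * ((nbRad (d + 1) L : ℝ) + L) + 8 * (((d + 1 : ℕ) : ℝ) * L) + 2 * L) * (((d + 1 : ℕ) : ℝ) * (2 * nbRad (d + 1) L + 1) ^ (d + 1)))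
          / ((L : ℝ) / (L : ℝ) ^ (d + 1))))) * Cb + 768 * (((d + 1 : ℕ) : ℝ) + 1) * L * (3 + 12 * ((d + 1 : ℕ) : ℝ)) * Cb + 2 * |thetaLoc (d + 1) L| + 216 * Xs / lam + |cruxC (d + 1) L| + 6 * |C0 (d + 1)| + 1024 * (((d + 1 : ℕ) : ℝ) + 1) * (((d + 1 : ℕ) : ℝ) + 4) * (L : ℝ) ^ 2 + 1) by linarith only [n2, nCb2, nρ, nKd, nD1, nθ, nX, ncx, nc0, nH2]) hε.le).trans hεM
  have qH2 : ε * (1024 * (((d + 1 : ℕ) : ℝ) + 1) * (((d + 1 : ℕ) : ℝ) + 4) * (L : ℝ) ^ 2) ≤ 1 :=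
    (mul_le_mul_of_nonneg_left (show 1024 * (((d + 1 : ℕ) : ℝ) + 1) * (((d + 1 : ℕ) : ℝ) + 4) * (L : ℝ) ^ 2 ≤ (3 + 3 * Cb + 12 * (3 + 12 * ((d + 1 : ℕ) : ℝ)) ^ 2 * Cb / rho0 (d + 1) L ^ 2 + 3 * (8 * (3 + 12 * ((d + 1 : ℕ) : ℝ)) * (2 + 2 * ((((d + 1 : ℕ) : ℝ) + 1) * L)
        * (1 + ((1250 * ((nbRad (d + 1) L : ℝ) + L) + 8 * (((d + 1 : ℕ) : ℝ) * L) + 2 * L) * (((d + 1 : ℕ) : ℝ) * (2 * nbRad (d + 1) L + 1) ^ (d + 1)))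
          / ((L : ℝ) / (L : ℝ) ^ (d + 1))))) * Cb + 768 * (((d + 1 : ℕ) : ℝ) + 1) * L * (3 + 12 * ((d + 1 : ℕ) : ℝ)) * Cb + 2 * |thetaLoc (d + 1) L| + 216 * Xs / lam + |cruxC (d + 1) L| + 6 * |C0 (d + 1)| + 1024 * (((d + 1 : ℕ) : ℝ) + 1) * (((d + 1 : ℕ) : ℝ) + 4) * (L : ℝ) ^ 2 + 1) by linarith only [n2, nCb2, nρ, nKd, nD1, nθ, nX, ncx, nc0, nH2]) hε.le).trans hεM
  -- the scalar `ε`-conditions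
  have hε1' : ε ≤ 1 := by linarith only [q2, hε]
  have hle : 0 < lam * ε := mul_pos hl0 hε
  have hθabs : thetaLoc (d + 1) L * ε ≤ |thetaLoc (d + 1) L| * ε := mul_le_mul_of_nonneg_right (le_abs_self _) hε.le
  have hθhalf : thetaLoc (d + 1) L * ε ≤ 1 / 2 := by linarith only [hθabs, qθ]
  have hθl : thetaLoc (d + 1) L * ε < 1 := by linarith only [hθhalf]
  have hcrux : cruxC (d + 1) L * ε < 1 := by
    have h := mul_le_mul_of_nonneg_right (le_abs_self (cruxC (d + 1) L)) hε.le
    linarith only [h, qcx, hε]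
  have hε1 : 16 * C0 (d + 1) * ε ≤ 3 := by
    have h := mul_le_mul_of_nonneg_right (le_abs_self (C0 (d + 1))) hε.le
    linarith only [h, qc0]
  have hε2 : 1024 * (((d + 1 : ℕ) : ℝ) + 1) * (((d + 1 : ℕ) : ℝ) + 4) * (L : ℝ) ^ 2 * ε ≤ 1 := by linarith only [qH2]
  have hCc0 : (0 : ℝ) ≤ (curl1C (d + 1) L / (1 - thetaLoc (d + 1) L * ε)) := div_nonneg hcurl (by linarith only [hθhalf])
  have hCc : (curl1C (d + 1) L / (1 - thetaLoc (d + 1) L * ε)) ≤ (2 * curl1C (d + 1) L) := by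
    rw [div_le_iff₀ (by linarith only [hθhalf])]
    have h := mul_le_mul_of_nonneg_left (show (1 : ℝ) / 2 ≤ 1 - thetaLoc (d + 1) L * ε by linarith only [hθhalf]) hCcs0
    linarith only [h]
  -- `β₀ = log (1 + ε / (8 + 64·G_β))`
  have hden : (0 : ℝ) < 8 + 64 * G := by linarith only [hGB0]
  have hw0 : (0 : ℝ) < lam * ε / (8 + 64 * G) := div_pos hle hden
  refine ⟨Real.log (1 + lam * ε / (8 + 64 * G)), Real.log_pos (by linarith only [hw0]), ?_⟩
  intro β hβ hβle
  have hexp : Real.exp β ≤ 1 + lam * ε / (8 + 64 * G) := by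
    have h := Real.exp_le_exp.mpr hβle
    rwa [Real.exp_log (by linarith only [hw0])] at h
  have hw8 : lam * ε / (8 + 64 * G) * (8 + 64 * G) = lam * ε := div_mul_cancel₀ _ hden.ne'
  have hwnn : (0 : ℝ) ≤ G * (lam * ε / (8 + 64 * G)) := mul_nonneg hGB0 hw0.le
  have hlamε : lam * ε ≤ ε := (mul_lt_of_lt_one_left hε hl1).le
  have hβp0 : (0 : ℝ) ≤ (4 * (Real.exp β - 1)) := by have := Real.add_one_le_exp β; linarith only [this, hβ]
  have hβp1 : (4 * (Real.exp β - 1)) ≤ ε / 2 := by linarith only [hexp, hw8, hwnn, hlamε]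
  have hβp2 : 16 * G * (4 * (Real.exp β - 1)) ≤ lam * ε := by
    have h := mul_le_mul_of_nonneg_left (show Real.exp β - 1 ≤ lam * ε / (8 + 64 * G) by linarith only [hexp]) hGB0
    linarith only [h, hw8, hw0]
  have hT0 : (0 : ℝ) ≤ (lam * ε + 4 * (Real.exp β - 1) + ε) := by linarith only [hle, hε, hβp0]
  have hT2 : (lam * ε + 4 * (Real.exp β - 1) + ε) ≤ 3 * ε := by linarith only [hβp1, hlamε, hε.le]
  have hT1 : (lam * ε + 4 * (Real.exp β - 1) + ε) ≤ 1 := by linarith only [hT2, q2]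
  -- the datum of constants
  intro N _ Kc CP C₀ C₁ αh νh κh hN hKc hCP hls hP hline hC₀ hC₀b' hC₁ hC₁b'
  have hC₀b : C₀ ≤ Cb := by rw [hCb]; exact hC₀b'.trans (le_add_of_nonneg_right zero_le_one)
  have hC₁b : C₁ ≤ Cb := by rw [hCb]; exact hC₁b'.trans (le_add_of_nonneg_right zero_le_one)
  have hC₀T : C₀ * (lam * ε + 4 * (Real.exp β - 1) + ε) ≤ Cb * (3 * ε) := mul_le_mul hC₀b hT2 hT0 hCb0
  have hC₀T1 : C₀ * (lam * ε + 4 * (Real.exp β - 1) + ε) ≤ 1 := by linarith only [hC₀T, qCb]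
  have hF51a : 4 * (3 + 12 * ((d + 1 : ℕ) : ℝ)) ^ 2 * (C₀ * (lam * ε + 4 * (Real.exp β - 1) + ε)) ≤ rho0 (d + 1) L ^ 2 := by
    have e : 12 * (3 + 12 * ((d + 1 : ℕ) : ℝ)) ^ 2 * Cb / rho0 (d + 1) L ^ 2 * rho0 (d + 1) L ^ 2 = 12 * (3 + 12 * ((d + 1 : ℕ) : ℝ)) ^ 2 * Cb := div_mul_cancel₀ _ (pow_ne_zero 2 hρ.ne')
    have h := mul_le_mul_of_nonneg_right qρ (sq_nonneg (rho0 (d + 1) L))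
    rw [mul_assoc, e, one_mul] at h
    have g := mul_le_mul_of_nonneg_left hC₀T (mul_nonneg (by norm_num : (0:ℝ) ≤ 4) (sq_nonneg ((3 + 12 * ((d + 1 : ℕ) : ℝ)))))
    linarith only [h, g]
  have hF51b : (8 * (3 + 12 * ((d + 1 : ℕ) : ℝ)) * (2 + 2 * ((((d + 1 : ℕ) : ℝ) + 1) * L)
        * (1 + ((1250 * ((nbRad (d + 1) L : ℝ) + L) + 8 * (((d + 1 : ℕ) : ℝ) * L) + 2 * L) * (((d + 1 : ℕ) : ℝ) * (2 * nbRad (d + 1) L + 1) ^ (d + 1)))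
          / ((L : ℝ) / (L : ℝ) ^ (d + 1))))) * (C₀ * (lam * ε + 4 * (Real.exp β - 1) + ε)) ≤ 1 := by
    have g := mul_le_mul_of_nonneg_left hC₀T hKd0
    linarith only [g, qKd]
  have hF51c : 256 * (((d + 1 : ℕ) : ℝ) + 1) * L * (3 + 12 * ((d + 1 : ℕ) : ℝ)) * (C₀ * (lam * ε + 4 * (Real.exp β - 1) + ε)) ≤ 1 := by
    have g := mul_le_mul_of_nonneg_left hC₀T (mul_nonneg (mul_nonneg (mul_nonneg (by norm_num : (0:ℝ) ≤ 256) hD10) hL0) hK30)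
    linarith only [g, qD1]
  -- the budget: `T·X + ec·Y + ek·Z ≤ 1/24`
  have hTX : (lam * ε + 4 * (Real.exp β - 1) + ε) * Xs ≤ lam / 72 := by
    have g := mul_le_mul_of_nonneg_right hT2 hXs0
    have e : 216 * Xs / lam * lam = 216 * Xs := div_mul_cancel₀ _ hl0.ne'
    have q := mul_le_mul_of_nonneg_right qX hl0.le
    rw [mul_assoc, e, one_mul] at q
    linarith only [g, q]
  have hS0 : (lam * ε + 4 * (Real.exp β - 1) + ε) * Xs + Real.exp (-(c * ℓ)) * (K * (2 * curl1C (d + 1) L) + 8 * K * (Fintype.card (T4AveragingDeficitWall.Plane (d + 1)) : ℝ) * Cb) + Real.exp (-(kappa163 (d + 1) / (d + 1) / 2 * ℓ)) * Z ≤ lam / 24 := by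
    linarith only [hTX, hYx, hZx]
  have hS := hS0
  rw [hXs, hZ] at hS
  have hS1 := hS.trans (show lam / 24 ≤ 1 / 24 by linarith only [hl1])
  have hβp2' := hβp2
  rw [hG] at hβp2'
  have hBR := budgetR_of_regime (K := K) (ec := Real.exp (-(c * ℓ))) (ek := Real.exp (-(kappa163 (d + 1) / (d + 1) / 2 * ℓ))) (Cc := (curl1C (d + 1) L / (1 - thetaLoc (d + 1) L * ε))) (Cc' := (2 * curl1C (d + 1) L)) (Kd := (8 * (3 + 12 * ((d + 1 : ℕ) : ℝ)) * (2 + 2 * ((((d + 1 : ℕ) : ℝ) + 1) * L)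
        * (1 + ((1250 * ((nbRad (d + 1) L : ℝ) + L) + 8 * (((d + 1 : ℕ) : ℝ) * L) + 2 * L) * (((d + 1 : ℕ) : ℝ) * (2 * nbRad (d + 1) L + 1) ^ (d + 1)))
          / ((L : ℝ) / (L : ℝ) ^ (d + 1)))))) (cP := (Fintype.card (T4AveragingDeficitWall.Plane (d + 1)) : ℝ))
    (Cg := (2 * (CdecD d * (((d : ℝ) + 1) * (2 * ((d : ℝ) + 1))
              * ((2 + 32 / (kappa163 (d + 1) / (d + 1)) ^ 2) * latticeConst (d + 1) (kappa163 (d + 1) / (d + 1) / 2)))))) (D := ((d : ℝ) + 1)) (K₃ := (3 + 12 * ((d + 1 : ℕ) : ℝ))) (K₄ := (4 * (3 + 12 * ((d + 1 : ℕ) : ℝ)) ^ 3 / rho0 (d + 1) L ^ 2)) (Cd := CdecD d) (lc := latticeConst (d + 1) (kappa163 (d + 1) / (d + 1) / 2)) (lq := (4 * ((ℓ + 1 : ℕ) : ℝ) + 2)) (nF := (Fintype.card n : ℝ)) (C₀ := C₀) (C₁ := C₁)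
    (Cb := Cb) (T := (lam * ε + 4 * (Real.exp β - 1) + ε)) hK hec0 hec1 hek0 hCc0 hCc hKd0 hcP0 hCg0 hD0 hK30 hK40 hCd0 hlc0 hlq0 hnF0 hT0 hT1 hC₀ hC₀b hC₁ hC₁b hCb1 hS1
  have hBC := budgetC_of_regime_ratio (K := K) (ec := Real.exp (-(c * ℓ))) (ek := Real.exp (-(kappa163 (d + 1) / (d + 1) / 2 * ℓ))) (Cc := (curl1C (d + 1) L / (1 - thetaLoc (d + 1) L * ε))) (Cc' := (2 * curl1C (d + 1) L)) (Kd := (8 * (3 + 12 * ((d + 1 : ℕ) : ℝ)) * (2 + 2 * ((((d + 1 : ℕ) : ℝ) + 1) * L)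
        * (1 + ((1250 * ((nbRad (d + 1) L : ℝ) + L) + 8 * (((d + 1 : ℕ) : ℝ) * L) + 2 * L) * (((d + 1 : ℕ) : ℝ) * (2 * nbRad (d + 1) L + 1) ^ (d + 1)))
          / ((L : ℝ) / (L : ℝ) ^ (d + 1)))))) (cP := (Fintype.card (T4AveragingDeficitWall.Plane (d + 1)) : ℝ))
    (Cg := (2 * (CdecD d * (((d : ℝ) + 1) * (2 * ((d : ℝ) + 1))
              * ((2 + 32 / (kappa163 (d + 1) / (d + 1)) ^ 2) * latticeConst (d + 1) (kappa163 (d + 1) / (d + 1) / 2)))))) (D := ((d : ℝ) + 1)) (K₃ := (3 + 12 * ((d + 1 : ℕ) : ℝ))) (K₄ := (4 * (3 + 12 * ((d + 1 : ℕ) : ℝ)) ^ 3 / rho0 (d + 1) L ^ 2)) (Cd := CdecD d) (lc := latticeConst (d + 1) (kappa163 (d + 1) / (d + 1) / 2)) (lq := (4 * ((ℓ + 1 : ℕ) : ℝ) + 2)) (nF := (Fintype.card n : ℝ)) (C₀ := C₀) (C₁ := C₁)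
    (Cb := Cb) (T := (lam * ε + 4 * (Real.exp β - 1) + ε)) (βp := (4 * (Real.exp β - 1))) (ε := ε) (lam := lam) hK hec0 hec1 hek0 hek1 hCc0 hCc hKd0 hcP0 hCg0 hD0 hK30 hK40 hCd0 hlc0 hlq0
    hnF0 hT0 hT1 hC₀ hC₀b hC₁ hC₁b hCb1 hl0.le hε.le hβp0 hβp1 hβp2' hS
  intro hchart hdecomp
  exact hF N ℓ Kc ε (lam * ε) (lam * ε / 2) CP β (lam * ε / 4) (1 / 4) C₀ C₁ αh νh κh hN hε hε1 hε2
    (by linarith only [hle]) (by linarith only [hle]) (mul_lt_of_lt_one_left hε hl1) hCP hβ hls hP hθl hε1'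
    hline hℓ1 hKc (by linarith only [hle]) (by norm_num) (by norm_num) (by linarith only [hle])
    (by rw [div_lt_iff₀ (by norm_num : (0:ℝ) < 1 - 1 / 4)]; linarith only [hle]) hcrux hC₀ hC₁ hF51a hF51b hF51c hC₀T1
    hBR hBC hchart hdecomp

end Summit.QuantumFields.BalabanUV.T4Continuum.NE7OneStepOfLocalChartRatioWideDec
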